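import Mathlib
import Literature.NumberTheory.Sieve.Maynard2016HistDensityProof
import HarnessLib

/-!
# Maynard 2016, Lemma 7: reduction to the normalised numerator estimate (via Lemma 6)

Topic `Literature/NumberTheory/Sieve`. J. Maynard, *Large gaps between primes*, Ann. of Math. (2)
183 (2016), 915–933 = arXiv:1408.5110, §6, proof of Lemma 7, first step (display (6.21) and the
sentence "We now replace `α_{m,q}` with a slightly more manageable expression … Substituting … our
bound for `α_{m,q}` from Lemma 6").

Lemma 7 bounds `Σ_{q ∈ 𝓘_m prime} μ_{m,q}(p₀)` from below, where
`μ_{m,q}(a) = α_{m,q} · (class sum of a)` and `α_{m,q}⁻¹` is the normalising sum. Lemma 6 evaluates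
`α_{m,q}⁻¹ = (1 + o_k(1)) M_{m,q}`, `M_{m,q} = U 𝔖_{m,q} I_k^{(1)}(F) I_k^{(2)}(G) / (m (log x)^k (log y)^k)`
(`normMain`), uniformly in the prime `q ∈ [x/2, x]`. Hence (this file, PROVED):

* `lemma7_of_lemma6_main : Lemma6 → Lemma7Main → Lemma7`, where `Lemma7Main` is Lemma 7 with
  `μ_{m,q}(p₀)` replaced by `(class sum of p₀ mod q) / M_{m,q}` — the estimate the source actually
  proves in displays (6.22)–(6.31) (positivity and the terms `n = p₀ − hq`, residue classes modulo
  `P_w`, the lower bound for `𝔖_{m,q}⁻¹`, Bombieri–Vinogradov for the primes `q ∈ 𝓘_m`, and the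
  evaluation of the resulting complete sums). The deduction is elementary: `0 ≤ S ≤ N` and
  `|N − M| ≤ κ₁ M` give `S/M ≤ (1 + κ₁) S/N`, and `(1 − κ) ≤ (1 − κ₁)/(1 + κ₁)` for `κ₁ = min(κ,1)/2`.
* Consequences with Lemma 8 now a theorem (`lemma8_holds`): `theorem1_of_lemma6_main :
  Lemma6 → Lemma7Main → Maynard2016_theorem1` and `forall_rankinConstant_of_lemma6_main`.

`Lemma7Main` is a NAMED FACT (`def … : Prop`), not proved here.

## References

* J. Maynard, *Large gaps between primes*, Ann. of Math. (2) 183 (2016), 915–933; arXiv:1408.5110,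
  Lemma 6, Lemma 7 (proof, displays (6.21)–(6.31)). [Maynard2016LargeGaps]
-/

open Filter Finset MeasureTheory
open scoped Topology

namespace Literature.NumberTheory.Sieve

namespace Maynard2016

/-! ### The main term of Lemma 6 and the normalised numerator estimate -/

/-- The main term of Lemma 6 for `α_{m,q}⁻¹`:
`M_{m,q} = U 𝔖_{m,q} I_k^{(1)}(F) I_k^{(2)}(G) / (m (log x)^k (log y)^k)`. [cite: Maynard2016LargeGaps, Lemma 6] -/
noncomputable def normMain {k J : ℕ} (cj : Fin J → ℝ) (Fd : Fin k → Fin J → ℝ → ℝ) (G : ℝ → ℝ)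
    (C_U ε : ℝ) (x m q : ℕ) : ℝ :=
  U C_U ε x * singSeriesMQ k ε x m q * I1 cj Fd * I2 k G /
    (m * (Real.log x) ^ k * (Real.log (y ε x)) ^ k)

/-- **Maynard 2016, Lemma 7 with `α_{m,q}` replaced by `M_{m,q}⁻¹`** (the estimate established in
the proof of Lemma 7, displays (6.22)–(6.31), after the substitution of Lemma 6): with the
quantifiers and hypotheses of `Lemma7`,
`Σ_{q ∈ 𝓘_m prime} (Σ_{n ≤ U/m, n ≡ p₀ (q), (n(mn−1),P_w)=1} (Σ_{d,e} λ_{d,e})²) / M_{m,q}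
  ≥ (1 − κ) c (B − A) (Σ_i J_k^{(1),i}(F)) J_k^{(2)}(G) / ((log x) |𝓡_m| I_k^{(1)}(F) I_k^{(2)}(G))`.
Named fact, not proved here (positivity and the terms `n = p₀ − hq`, residue classes mod `P_w`,
the bound (6.24)–(6.25) for `𝔖_{m,q}⁻¹`, Bombieri–Vinogradov for primes `q ∈ 𝓘_m` in progressions,
evaluation of the complete sums). [cite: Maynard2016LargeGaps, Lemma 7 (proof, displays (6.22)–(6.31))] -/
def Lemma7Main : Prop :=
  ∀ C_U : ℝ, 0 < C_U → ∀ᶠ ε : ℝ in 𝓝[>] 0, ∃ c : ℝ, 0 < c ∧ ∀ k : ℕ, 2 ≤ k →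
    ∀ (J : ℕ) (cj : Fin J → ℝ) (Fd : Fin k → Fin J → ℝ → ℝ) (G : ℝ → ℝ),
      IsSieveData k J cj Fd G → 0 < I1 cj Fd → 0 < I2 k G → ∀ δ : ℝ, 0 < δ → ∀ κ : ℝ, 0 < κ →
        ∀ᶠ x : ℕ in atTop,
          ∀ m : ℕ, 1 ≤ m → Even m → (m : ℝ) < U C_U ε x / (z x * (Real.log (Real.log x)) ^ 2) →
            ∀ A B : ℝ, (x : ℝ) / 2 ≤ A → B ≤ x →
              δ * (Rm C_U ε x m).card * Real.log x ≤ B - A →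
                ∀ p₀ ∈ Rm C_U ε x m,
                  (∀ i : Fin k, (hTuple k x i : ℝ) * x < p₀ ∧
                      (p₀ : ℝ) < U C_U ε x / m - hTuple k x i * x) →
                    (1 - κ) * c * ((B - A) * (∑ i, J1 cj Fd i) * J2 k G) /
                        (Real.log x * (Rm C_U ε x m).card * I1 cj Fd * I2 k G) ≤
                      ∑ q ∈ intervalPrimes A B,
                        classSum cj Fd G C_U ε x m q (p₀ % q) / normMain cj Fd G C_U ε x m q

/-! ### Elementary lemmas -/

/-- Class sums are non-negative. [cite: Maynard2016LargeGaps, §4 display (4.1)] -/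
theorem classSum_nonneg {k J : ℕ} (cj : Fin J → ℝ) (Fd : Fin k → Fin J → ℝ → ℝ) (G : ℝ → ℝ)
    (C_U ε : ℝ) (x m q a : ℕ) : 0 ≤ classSum cj Fd G C_U ε x m q a := by
  unfold classSum
  exact sum_nonneg fun _ _ => sq_nonneg _

/-- A class sum is at most the normalising sum. [cite: Maynard2016LargeGaps, §4 display (4.1)] -/
theorem classSum_le_normInv {k J : ℕ} (cj : Fin J → ℝ) (Fd : Fin k → Fin J → ℝ → ℝ) (G : ℝ → ℝ)
    (C_U ε : ℝ) (x m q a : ℕ) :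
    classSum cj Fd G C_U ε x m q a ≤ normInv cj Fd G C_U ε x m q := by
  unfold classSum normInv
  exact Finset.sum_le_sum_of_subset_of_nonneg (Finset.filter_subset _ _)
    (fun _ _ _ => sq_nonneg _)

/-- If `0 ≤ S ≤ N` and `|N − M| ≤ κ M` with `0 < κ < 1`, then `S / ((1 + κ) M) ≤ S / N` (all
degenerate cases included, with `x / 0 = 0`). [cite: Maynard2016LargeGaps, Lemma 7 (proof)] -/
theorem div_main_le_div_norm {S N M κ : ℝ} (hS0 : 0 ≤ S) (hSN : S ≤ N) (hκ0 : 0 < κ)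
    (hκ1 : κ < 1) (h : |N - M| ≤ κ * M) : S / ((1 + κ) * M) ≤ S / N := by
  rcases le_or_gt M 0 with hM | hM
  · have habs : |N - M| ≤ 0 := h.trans (by nlinarith)
    have hNM : N = M := by
      have := abs_nonneg (N - M)
      have h0 : |N - M| = 0 := le_antisymm habs this
      linarith [abs_eq_zero.1 h0, sub_eq_zero.1 (abs_eq_zero.1 h0)]
    have hS : S = 0 := by linarith
    rw [hS, zero_div, zero_div]
  · have h1 := (abs_sub_le_iff.1 h).1
    have h2 := (abs_sub_le_iff.1 h).2
    have hN : 0 < N := by nlinarith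
    exact div_le_div_of_nonneg_left hS0 hN (by linarith)

/-- `J_k^{(1),i}(F) ≥ 0`. [cite: Maynard2016LargeGaps, Lemma 7 (definition of J^(1))] -/
theorem J1_nonneg {k J : ℕ} (cj : Fin J → ℝ) (Fd : Fin k → Fin J → ℝ → ℝ) (i : Fin k) :
    0 ≤ J1 cj Fd i := by
  unfold J1
  exact integral_nonneg fun _ => sq_nonneg _

/-- `J_k^{(2)}(G) ≥ 0`. [cite: Maynard2016LargeGaps, Lemma 7 (definition of J^(2))] -/
theorem J2_nonneg (k : ℕ) (G : ℝ → ℝ) : 0 ≤ J2 k G := by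
  unfold J2
  exact mul_nonneg (sq_nonneg _) (pow_nonneg (integral_nonneg fun _ => sq_nonneg _) _)

/-! ### Lemma 7 from Lemma 6 and the normalised numerator estimate -/

/-- **Lemma 7 ⇐ Lemma 6 ∧ `Lemma7Main`** (the substitution of Lemma 6 into (6.21), PROVED).
[cite: Maynard2016LargeGaps, Lemma 7 (proof, display (6.21) and the substitution of Lemma 6)] -/
theorem lemma7_of_lemma6_main (h6 : Lemma6) (h7 : Lemma7Main) : Lemma7 := by
  intro C_U hCU
  filter_upwards [h6 C_U hCU, h7 C_U hCU] with ε h6ε h7ε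
  obtain ⟨c, hc, h7c⟩ := h7ε
  refine ⟨c, hc, ?_⟩
  intro k hk J cj Fd G hD hI1 hI2 δ hδ κ hκ
  -- the auxiliary precision `κ₁ = min(κ,1)/2`
  set κ₁ : ℝ := min κ 1 / 2 with hκ₁def
  have hκ₁0 : 0 < κ₁ := by
    have : 0 < min κ 1 := lt_min hκ one_pos
    positivity
  have hκ₁1 : κ₁ ≤ 1 / 2 := by
    have : min κ 1 ≤ 1 := min_le_right _ _
    linarith
  have hκ₁κ : 2 * κ₁ ≤ κ := by
    have : min κ 1 ≤ κ := min_le_left _ _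
    linarith
  have hκ₁lt : κ₁ < 1 := by linarith
  filter_upwards [h6ε k (by omega) J cj Fd G hD hI1 hI2 κ₁ hκ₁0,
    h7c k hk J cj Fd G hD hI1 hI2 δ hδ κ₁ hκ₁0, eventually_ge_atTop 1] with x h6x h7x hx1
  intro m hm1 hme hmU A B hA hB hAB p₀ hp₀ hp₀'
  have h7' := h7x m hm1 hme hmU A B hA hB hAB p₀ hp₀ hp₀'
  have hlog : 0 ≤ Real.log x := Real.log_nonneg (by exact_mod_cast hx1)
  have hBA : 0 ≤ B - A := by
    have : 0 ≤ δ * (Rm C_U ε x m).card * Real.log x := by positivity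
    linarith
  have hx0 : (0 : ℝ) ≤ x := by positivity
  have hB0 : 0 ≤ B := by linarith
  -- termwise comparison `S_q / M_q ≤ (1 + κ₁) μ_q`
  have hterm : ∀ q ∈ intervalPrimes A B,
      classSum cj Fd G C_U ε x m q (p₀ % q) / normMain cj Fd G C_U ε x m q ≤
        (1 + κ₁) * gpyMeasure cj Fd G C_U ε x m q (p₀ % q) := by
    intro q hq
    obtain ⟨hqP, hAq, hqB⟩ := (mem_intervalPrimes hB0).1 hq
    have h6q := h6x m hm1 hme hmU q hqP (by linarith) (by linarith)
    have hcmp := div_main_le_div_norm (classSum_nonneg cj Fd G C_U ε x m q (p₀ % q))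
      (classSum_le_normInv cj Fd G C_U ε x m q (p₀ % q)) hκ₁0 hκ₁lt h6q
    have hne : (1 + κ₁) ≠ 0 := by linarith
    unfold gpyMeasure normMain
    calc classSum cj Fd G C_U ε x m q (p₀ % q) /
          (U C_U ε x * singSeriesMQ k ε x m q * I1 cj Fd * I2 k G /
            (m * (Real.log x) ^ k * (Real.log (y ε x)) ^ k))
        = (1 + κ₁) * (classSum cj Fd G C_U ε x m q (p₀ % q) /
            ((1 + κ₁) * (U C_U ε x * singSeriesMQ k ε x m q * I1 cj Fd * I2 k G /
              (m * (Real.log x) ^ k * (Real.log (y ε x)) ^ k)))) := by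
          rw [← mul_div_assoc, mul_div_mul_left _ _ hne]
      _ ≤ (1 + κ₁) * (classSum cj Fd G C_U ε x m q (p₀ % q) / normInv cj Fd G C_U ε x m q) :=
          mul_le_mul_of_nonneg_left hcmp (by linarith)
  have hsum : ∑ q ∈ intervalPrimes A B,
      classSum cj Fd G C_U ε x m q (p₀ % q) / normMain cj Fd G C_U ε x m q ≤
        (1 + κ₁) * ∑ q ∈ intervalPrimes A B, gpyMeasure cj Fd G C_U ε x m q (p₀ % q) := by
    rw [Finset.mul_sum]
    exact Finset.sum_le_sum hterm
  -- the common non-negative factor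
  set T : ℝ := c * ((B - A) * (∑ i, J1 cj Fd i) * J2 k G) /
    (Real.log x * (Rm C_U ε x m).card * I1 cj Fd * I2 k G) with hT
  have hT0 : 0 ≤ T := by
    have hY : 0 ≤ (B - A) * (∑ i, J1 cj Fd i) * J2 k G :=
      mul_nonneg (mul_nonneg hBA (sum_nonneg fun i _ => J1_nonneg cj Fd i)) (J2_nonneg k G)
    have hD : 0 ≤ Real.log x * (Rm C_U ε x m).card * I1 cj Fd * I2 k G :=
      mul_nonneg (mul_nonneg (mul_nonneg hlog (Nat.cast_nonneg _)) hI1.le) hI2.le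
    exact div_nonneg (mul_nonneg hc.le hY) hD
  have e1 : (1 - κ) * c * ((B - A) * (∑ i, J1 cj Fd i) * J2 k G) /
      (Real.log x * (Rm C_U ε x m).card * I1 cj Fd * I2 k G) = (1 - κ) * T := by
    rw [hT]
    ring
  have e2 : (1 - κ₁) * c * ((B - A) * (∑ i, J1 cj Fd i) * J2 k G) /
      (Real.log x * (Rm C_U ε x m).card * I1 cj Fd * I2 k G) = (1 - κ₁) * T := by
    rw [hT]
    ring
  rw [e2] at h7'
  have hpos : 0 < 1 + κ₁ := by linarith
  have hcoef : (1 - κ) * (1 + κ₁) ≤ 1 - κ₁ := by nlinarith [mul_pos hκ hκ₁0]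
  have hineq : (1 - κ) * T ≤ (1 - κ₁) * T / (1 + κ₁) := by
    rw [le_div_iff₀ hpos]
    have := mul_le_mul_of_nonneg_right hcoef hT0
    nlinarith
  calc (1 - κ) * c * ((B - A) * (∑ i, J1 cj Fd i) * J2 k G) /
        (Real.log x * (Rm C_U ε x m).card * I1 cj Fd * I2 k G) = (1 - κ) * T := e1
    _ ≤ (1 - κ₁) * T / (1 + κ₁) := hineq
    _ ≤ (∑ q ∈ intervalPrimes A B,
          classSum cj Fd G C_U ε x m q (p₀ % q) / normMain cj Fd G C_U ε x m q) / (1 + κ₁) :=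
        div_le_div_of_nonneg_right h7' hpos.le
    _ ≤ ∑ q ∈ intervalPrimes A B, gpyMeasure cj Fd G C_U ε x m q (p₀ % q) := by
        rw [div_le_iff₀ hpos, mul_comm]
        exact hsum

/-! ### Consequences -/

/-- `GPYMeasures` from Lemma 6 and `Lemma7Main` (Lemma 8 being a theorem). [cite: Maynard2016LargeGaps, Proposition 5 (proof)] -/
theorem gpyMeasures_of_lemma6_main (h6 : Lemma6) (h7 : Lemma7Main) : GPYMeasures :=
  gpyMeasures_of_lemma7 (lemma7_of_lemma6_main h6 h7)

/-- **Maynard's Theorem 1 from Lemma 6 and `Lemma7Main`.** [cite: Maynard2016LargeGaps, Theorem 1] -/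
theorem theorem1_of_lemma6_main (h6 : Lemma6) (h7 : Lemma7Main) :
    Literature.NumberTheory.Sieve.Maynard2016_theorem1 :=
  theorem1_of_lemma7 (lemma7_of_lemma6_main h6 h7)

/-- **`∀ c, RankinConstant c` from Lemma 6 and `Lemma7Main`.** [cite: Maynard2016LargeGaps, Theorem 1] -/
theorem forall_rankinConstant_of_lemma6_main (h6 : Lemma6) (h7 : Lemma7Main) (c : ℝ) :
    Literature.NumberTheory.Sieve.RankinConstant c :=
  forall_rankinConstant_of_lemma7 (lemma7_of_lemma6_main h6 h7) c

end Maynard2016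

end Literature.NumberTheory.Sieve
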